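import Summits.QuantumFields.YangMills.Theorems.BalabanUVNodesN15KingModelBlockCovarianceContinuumLimit

/-!
# BalabanUVNodes ∕ N15 — THE KING-MODEL RUNG (PART Ϡ-f): THE CONTINUUM BLOCK COVARIANCE `C^{(∞)}` IS A COVARIANCE — ITS QUADRATIC FORM
# `⟨φ, C^{(∞)}φ⟩ = a_∞⁻¹‖φ‖² + |Ω|⁻¹ Σ_q S_∞(p′(q))|φ̃(q)|²`, THE NOISE FLOOR `C^{(∞)} ≥ a_∞⁻¹`, THE CEILING `C^{(∞)} ≤ a_∞⁻¹ + (π∕2)^{2d}π^d(1 + 4∕π)^d∕m²`,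
# SYMMETRY AND TRANSLATION INVARIANCE
# (Track A, DAG node N15 = NE2; FAN-OUT v1.1 §N15 s3 «KING-MODEL RUNG … NE2's analogue DECIDED in the model»)

HONEST FRAMING.  Count-neutral (cell `pub-ymgap`, seat `pub-ymgap-dag-n15-e` g32; `--supports stmt-QuantumFields-27366 --as helper` = K3⁸
`SpineGivenEndpointR13SepCoPHV`).  TEMPLATE LITERATURE: C. King, *The U(1) Higgs model. I. The continuum limit*, Commun. Math. Phys. **102** (1986) 649–677
[King1986] — KING's OWN `A = 0` MODEL on the unit torus `Ω = Tor M`: the block-field covariance `(Δ^{(K)})⁻¹` ((2.13)–(2.14) p. 653, (4.5) p. 670; the rung's g0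
`blockCov`), King's plane waves (4.1)∕(4.35) (`chi`, `ft`, `parseval_dot`), and the explicit `K → ∞` limit `C^{(∞)} = blockCovLim` of part Ϡ-e.  NOT Bałaban's
`C^{(k)}(Λ)`; NOT a node discharge (N15 is booked through n15-a's knit, untouched here); nothing continuum-Yang–Mills ∕ ℝ⁴ ∕ OS ∕ mass-gap ∕ Clay.  0 `sorry`;
standard axioms; 0 `def`.

THE MATHEMATICS.  At level `K` the Woodbury split of part Ϛ and part Ϡ-d's `blockAvg_form` give the quadratic form EXACTLY: `⟨φ, (Δ^{(K)})⁻¹φ⟩ = a_K⁻¹‖φ‖² +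
|Ω|⁻¹Σ_q S_K(q)|φ̃(q)|²` (§1).  Both sides converge (`tendsto_blockCov`; `a_K⁻¹ → a_∞⁻¹`, `S_K(q) → S_∞(p′(q))`, parts Ϡ-c∕Ϡ-e), so by uniqueness of limits
`⟨φ, C^{(∞)}φ⟩ = a_∞⁻¹‖φ‖² + |Ω|⁻¹Σ_q S_∞(p′(q))|φ̃(q)|²` (§2) — no character identity is re-derived.  Since `S_∞ ≥ 0` and `S_∞ ≤ (π∕2)^{2d}π^d(1+4∕π)^d∕m²`
(part Ϡ-b) and `|Ω|⁻¹Σ_q|φ̃(q)|² = ‖φ‖²` (Plancherel), `a_∞⁻¹‖φ‖² ≤ ⟨φ, C^{(∞)}φ⟩ ≤ (a_∞⁻¹ + (π∕2)^{2d}π^d(1+4∕π)^d∕m²)‖φ‖²` (§3): the closed-form limit of NE2's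
unit-layer kernel is a strictly positive-definite, bounded, symmetric, translation-invariant kernel on `Ω` — the covariance of a non-degenerate Gaussian unit-lattice
field (the block-spin image of the continuum massive free field), with the block-spin noise `a_∞⁻¹` as its floor.

WHAT THIS FILE PROVES (kernel).  §1 ★★ **`blockCov_form`** (`⟨φ,(Δ^{(K)})⁻¹φ⟩ = a_K⁻¹‖φ‖² + |Ω|⁻¹Σ_q S_K(q)|φ̃(q)|²`, every `K`; general `effLaplacian_inv_form`).
§2 ★★★ **`blockCovLim_form`** (the quadratic form of `C^{(∞)}`).  §3 ★★ **`blockCovLim_form_ge`** (noise floor `a_∞⁻¹‖φ‖²`), ★★ **`blockCovLim_form_le`** (ceiling),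
★ `blockCovLim_form_pos` (strict positivity for `φ ≠ 0`), `blockCovLim_symm`, `blockCovLim_transl` (depends on `b′ − b` only).

HONEST SCOPE.  King's `A = 0` model on a finite unit torus; odd `L ≥ 2`, `a, m² > 0`; constants of the tree, not optimised.  Nothing here about Bałaban's `C^{(k)}(Λ; U)`.
N15 untouched; counts unmoved.  Locators: [King1986] (2.13)–(2.14) p.653, (4.1)–(4.5) p.670, (4.22) p.672, (4.35)–(4.36) p.674, Thm 2.1 (2.22) p.654.
-/

noncomputable section

open scoped BigOperators
open Finset Matrix Filter Topology

namespace Summit.QuantumFields.YangMills.BalabanUVNodes.N15KingModelRung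

open Literature.MathematicalPhysics.QuantumFieldTheory.Balaban1983to89.B5Prop11Plancherel (Tor fine chi sOf abs_sOf_le conj_chi)
open Literature.MathematicalPhysics.QuantumFieldTheory.Balaban1983to89
open Literature.MathematicalPhysics.QuantumFieldTheory.King1986 (aK aK_pos)
open Literature.MathematicalPhysics.QuantumFieldTheory.King1986.Torus

variable {d : ℕ}

/-! ## §1 The quadratic form of `(Δ^{(K)})⁻¹`, exactly -/

section Finite

variable (N : ℕ) [NeZero N] (M : Fin d → ℕ) [hM : ∀ μ, NeZero (M μ)]

/-- ★★ **`⟨φ, (Δ^{(K)})⁻¹φ⟩ = a⁻¹‖φ‖² + |Ω|⁻¹ Σ_q S(q)|φ̃(q)|²`** (`N ≥ 1`, `a, m² > 0`, `c = N²`) — part Ϛ's Woodbury split and part Ϡ-d's `blockAvg_form`.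
[cite: King1986, (2.13)–(2.14) p.653, (4.5) p.670, (4.35) p.674] -/
theorem effLaplacian_inv_form (hN1 : 1 ≤ N) {a m2 : ℝ} (ha : 0 < a) (hm : 0 < m2) (φ : Tor M → ℝ) :
    φ ⬝ᵥ ((effLaplacian N M a ((N : ℝ) ^ 2) m2)⁻¹ *ᵥ φ)
      = a⁻¹ * (φ ⬝ᵥ φ) + (Fintype.card (Tor M) : ℝ)⁻¹ * ∑ q : Tor M, Sfib N M ((N : ℝ) ^ 2) m2 q * ‖ft M φ q‖ ^ 2 := by
  rw [effLaplacian_inv_eq_noise_add_blockAvg N M hN1 ha hm, Matrix.add_mulVec, dotProduct_add, Matrix.smul_mulVec, Matrix.one_mulVec,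
    dotProduct_smul, smul_eq_mul, Matrix.smul_mulVec, dotProduct_smul, smul_eq_mul, blockAvg_form N M (by positivity) hm φ]

end Finite

section Rung

variable (L : ℕ) (M : Fin (d + 1) → ℕ) [hM : ∀ μ, NeZero (M μ)]

/-- ★★ **THE QUADRATIC FORM OF NE2's UNIT-LAYER KERNEL, EVERY LEVEL**: `Σ_{b,b′} φ(b)(Δ^{(K)})⁻¹(b,b′)φ(b′) = a_K⁻¹‖φ‖² + |Ω|⁻¹Σ_q S_K(q)|φ̃(q)|²` for the rung's
`blockCov L (L^K) M a m² K` (`L ≥ 2`, `a, m² > 0`, `K ≥ 1`). [cite: King1986, (2.13)–(2.14) p.653, (4.5) p.670, (4.35) p.674] -/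
theorem blockCov_form (hL : 2 ≤ L) {a m2 : ℝ} (ha : 0 < a) (hm : 0 < m2) {K : ℕ} (hK : 1 ≤ K) (φ : Tor M → ℝ) :
    haveI : NeZero L := ⟨by omega⟩
    φ ⬝ᵥ ((Matrix.of fun b b' => blockCov L (L ^ K) M a m2 K b b') *ᵥ φ)
      = (aK a L K)⁻¹ * (φ ⬝ᵥ φ)
        + (Fintype.card (Tor M) : ℝ)⁻¹ * ∑ q : Tor M, Sfib (L ^ K) M (((L ^ K : ℕ) : ℝ) ^ 2) m2 q * ‖ft M φ q‖ ^ 2 := by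
  haveI : NeZero L := ⟨by omega⟩
  have hL1 : (1 : ℝ) < L := by exact_mod_cast (show 1 < L by omega)
  have hN1 : 1 ≤ L ^ K := Nat.one_le_pow _ _ (by omega)
  have hmat : (Matrix.of fun b b' => blockCov L (L ^ K) M a m2 K b b') = (effLaplacian (L ^ K) M (aK a L K) (((L ^ K : ℕ) : ℝ) ^ 2) m2)⁻¹ := by
    ext b b'
    rfl
  rw [hmat, Nat.cast_pow]
  have h := effLaplacian_inv_form (L ^ K) M hN1 (aK_pos ha hL1 hK) hm φ
  rw [Nat.cast_pow] at h
  exact h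

/-! ## §2 The quadratic form of the limit -/

/-- ★★★ **THE QUADRATIC FORM OF THE CONTINUUM BLOCK COVARIANCE**: `⟨φ, C^{(∞)}φ⟩ = a_∞⁻¹‖φ‖² + |Ω|⁻¹ Σ_q S_∞(p′(q))|φ̃(q)|²` (`L` odd `≥ 2`, `a, m² > 0`, every unit
torus and every real `φ`) — both sides of `blockCov_form` converge as `K → ∞`; limits are unique. [cite: King1986, Thm 2.1 (2.22) p.654, (2.13)–(2.14) p.653, (4.5) p.670] -/
theorem blockCovLim_form (hLodd : Odd L) (hL : 2 ≤ L) {a m2 : ℝ} (ha : 0 < a) (hm : 0 < m2) (φ : Tor M → ℝ) :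
    φ ⬝ᵥ ((Matrix.of fun b b' => blockCovLim L M a m2 b b') *ᵥ φ)
      = (aInf a L)⁻¹ * (φ ⬝ᵥ φ) + (Fintype.card (Tor M) : ℝ)⁻¹ * ∑ q : Tor M, aliasSeries0 m2 (sOf M q) * ‖ft M φ q‖ ^ 2 := by
  haveI : NeZero L := ⟨by omega⟩
  have hL1 : (1 : ℝ) < L := by exact_mod_cast (show 1 < L by omega)
  -- the left sides converge to the form of the limit kernel
  have hleft : Tendsto (fun K : ℕ => φ ⬝ᵥ ((Matrix.of fun b b' => blockCov L (L ^ K) M a m2 K b b') *ᵥ φ)) atTop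
      (𝓝 (φ ⬝ᵥ ((Matrix.of fun b b' => blockCovLim L M a m2 b b') *ᵥ φ))) := by
    simp only [dotProduct, Matrix.mulVec, Matrix.of_apply]
    exact tendsto_finsetSum _ fun b _ =>
      (tendsto_finsetSum _ fun b' _ => (tendsto_blockCov L M hLodd hL ha hm b b').mul_const _).const_mul _
  -- the right sides converge to the claimed expression
  have hright : Tendsto (fun K : ℕ => (aK a L K)⁻¹ * (φ ⬝ᵥ φ)
        + (Fintype.card (Tor M) : ℝ)⁻¹ * ∑ q : Tor M, Sfib (L ^ K) M (((L ^ K : ℕ) : ℝ) ^ 2) m2 q * ‖ft M φ q‖ ^ 2) atTop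
      (𝓝 ((aInf a L)⁻¹ * (φ ⬝ᵥ φ) + (Fintype.card (Tor M) : ℝ)⁻¹ * ∑ q : Tor M, aliasSeries0 m2 (sOf M q) * ‖ft M φ q‖ ^ 2)) :=
    ((tendsto_inv_aK ha hL1).mul_const _).add
      (tendsto_const_nhds.mul (tendsto_finsetSum _ fun q _ => (tendsto_Sfib_pow L M hLodd hL hm q).mul_const _))
  have heq : (fun K : ℕ => φ ⬝ᵥ ((Matrix.of fun b b' => blockCov L (L ^ K) M a m2 K b b') *ᵥ φ))
      =ᶠ[atTop] (fun K : ℕ => (aK a L K)⁻¹ * (φ ⬝ᵥ φ)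
        + (Fintype.card (Tor M) : ℝ)⁻¹ * ∑ q : Tor M, Sfib (L ^ K) M (((L ^ K : ℕ) : ℝ) ^ 2) m2 q * ‖ft M φ q‖ ^ 2) := by
    filter_upwards [eventually_ge_atTop 1] with K hK
    exact blockCov_form L M hL ha hm hK φ
  exact tendsto_nhds_unique (hleft.congr' heq) hright

/-! ## §3 Floor, ceiling, positivity, symmetry, translation invariance -/

/-- ★★ **THE NOISE FLOOR**: `a_∞⁻¹‖φ‖² ≤ ⟨φ, C^{(∞)}φ⟩` (`S_∞ ≥ 0`) — the continuum block covariance dominates the block-spin white noise.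
[cite: King1986, (2.13)–(2.14) p.653, (4.5) p.670] -/
theorem blockCovLim_form_ge (hLodd : Odd L) (hL : 2 ≤ L) {a m2 : ℝ} (ha : 0 < a) (hm : 0 < m2) (φ : Tor M → ℝ) :
    (aInf a L)⁻¹ * (φ ⬝ᵥ φ) ≤ φ ⬝ᵥ ((Matrix.of fun b b' => blockCovLim L M a m2 b b') *ᵥ φ) := by
  rw [blockCovLim_form L M hLodd hL ha hm φ]
  have h : 0 ≤ (Fintype.card (Tor M) : ℝ)⁻¹ * ∑ q : Tor M, aliasSeries0 m2 (sOf M q) * ‖ft M φ q‖ ^ 2 :=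
    mul_nonneg (by positivity) (Finset.sum_nonneg fun q _ => mul_nonneg (aliasSeries0_nonneg hm.le _) (sq_nonneg _))
  linarith

/-- ★★ **THE CEILING**: `⟨φ, C^{(∞)}φ⟩ ≤ (a_∞⁻¹ + (π∕2)^{2(d+1)}π^{d+1}(1 + 4∕π)^{d+1}∕m²)·‖φ‖²` (part Ϡ-b's `aliasSeries0_le` + Plancherel).
[cite: King1986, (4.22) p.672, (4.35) p.674] -/
theorem blockCovLim_form_le (hLodd : Odd L) (hL : 2 ≤ L) {a m2 : ℝ} (ha : 0 < a) (hm : 0 < m2) (φ : Tor M → ℝ) :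
    φ ⬝ᵥ ((Matrix.of fun b b' => blockCovLim L M a m2 b b') *ᵥ φ)
      ≤ ((aInf a L)⁻¹ + (Real.pi / 2) ^ (2 * (d + 1)) * Real.pi ^ (d + 1) / m2 * (1 + 4 / Real.pi) ^ (d + 1)) * (φ ⬝ᵥ φ) := by
  rw [blockCovLim_form L M hLodd hL ha hm φ]
  set B := (Real.pi / 2) ^ (2 * (d + 1)) * Real.pi ^ (d + 1) / m2 * (1 + 4 / Real.pi) ^ (d + 1) with hB
  have hS : ∀ q : Tor M, aliasSeries0 m2 (sOf M q) * ‖ft M φ q‖ ^ 2 ≤ B * ‖ft M φ q‖ ^ 2 := fun q =>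
    mul_le_mul_of_nonneg_right (aliasSeries0_le hm (abs_sOf_le M q)) (sq_nonneg _)
  have hsum : ∑ q : Tor M, aliasSeries0 m2 (sOf M q) * ‖ft M φ q‖ ^ 2 ≤ B * ∑ q : Tor M, ‖ft M φ q‖ ^ 2 := by
    rw [Finset.mul_sum]
    exact Finset.sum_le_sum fun q _ => hS q
  have hpars : ∑ q : Tor M, ‖ft M φ q‖ ^ 2 = (Fintype.card (Tor M) : ℝ) * (φ ⬝ᵥ φ) := (parseval_dot M φ).symm
  have hcM : (0 : ℝ) < Fintype.card (Tor M) := by exact_mod_cast Fintype.card_pos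
  have h2 : (Fintype.card (Tor M) : ℝ)⁻¹ * ∑ q : Tor M, aliasSeries0 m2 (sOf M q) * ‖ft M φ q‖ ^ 2 ≤ B * (φ ⬝ᵥ φ) := by
    calc (Fintype.card (Tor M) : ℝ)⁻¹ * ∑ q : Tor M, aliasSeries0 m2 (sOf M q) * ‖ft M φ q‖ ^ 2
        ≤ (Fintype.card (Tor M) : ℝ)⁻¹ * (B * ∑ q : Tor M, ‖ft M φ q‖ ^ 2) := mul_le_mul_of_nonneg_left hsum (by positivity)
      _ = B * (φ ⬝ᵥ φ) := by rw [hpars]; field_simp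
  linarith

/-- ★ **STRICT POSITIVITY**: `⟨φ, C^{(∞)}φ⟩ > 0` for `φ ≠ 0` — `C^{(∞)}` is the covariance of a NON-DEGENERATE Gaussian unit-lattice field.
[cite: King1986, (2.13)–(2.14) p.653, Thm 2.1 (2.22) p.654] -/
theorem blockCovLim_form_pos (hLodd : Odd L) (hL : 2 ≤ L) {a m2 : ℝ} (ha : 0 < a) (hm : 0 < m2) {φ : Tor M → ℝ} (hφ : φ ≠ 0) :
    0 < φ ⬝ᵥ ((Matrix.of fun b b' => blockCovLim L M a m2 b b') *ᵥ φ) := by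
  have hL1 : (1 : ℝ) < L := by exact_mod_cast (show 1 < L by omega)
  have hge := blockCovLim_form_ge L M hLodd hL ha hm φ
  have hφφ : 0 < φ ⬝ᵥ φ := by
    obtain ⟨b, hb⟩ := Function.ne_iff.mp hφ
    have hb : φ b ≠ 0 := hb
    have h1 : φ b * φ b ≤ φ ⬝ᵥ φ := Finset.single_le_sum (f := fun i => φ i * φ i) (fun i _ => mul_self_nonneg (φ i)) (Finset.mem_univ b)
    have h2 : 0 < φ b * φ b := mul_self_pos.mpr hb
    linarith
  have hainv : 0 < (aInf a L)⁻¹ := inv_pos.mpr (aInf_pos ha hL1)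
  nlinarith

/-- `C^{(∞)}` is symmetric: `C^{(∞)}(b, b′) = C^{(∞)}(b′, b)` (`Re e^{iq·(b′−b)} = Re e^{iq·(b−b′)}`). [cite: King1986, (4.1) p.670] -/
theorem blockCovLim_symm (a m2 : ℝ) (b b' : Tor M) : blockCovLim L M a m2 b b' = blockCovLim L M a m2 b' b := by
  unfold blockCovLim
  have hre : ∀ q : Tor M, (chi M q (b' - b)).re = (chi M q (b - b')).re := fun q => by
    rw [show b - b' = -(b' - b) by abel, ← chi_neg_left, ← conj_chi, Complex.conj_re]
  simp_rw [hre]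
  congr 2
  by_cases h : b = b'
  · subst h; rfl
  · rw [if_neg h, if_neg (Ne.symm h)]

/-- `C^{(∞)}` is translation invariant: `C^{(∞)}(b + v, b′ + v) = C^{(∞)}(b, b′)`. [cite: King1986, (2.21) p.654 (periodic boundary conditions), (4.1) p.670] -/
theorem blockCovLim_transl (a m2 : ℝ) (b b' v : Tor M) : blockCovLim L M a m2 (b + v) (b' + v) = blockCovLim L M a m2 b b' := by
  unfold blockCovLim
  rw [add_sub_add_right_eq_sub]
  congr 2
  by_cases h : b = b'
  · subst h; simp
  · rw [if_neg h, if_neg (fun h' => h (add_right_cancel h'))]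

end Rung

end Summit.QuantumFields.YangMills.BalabanUVNodes.N15KingModelRung

end
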